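import Summits.CriticalPhenomena.CardyFormulaZ2.Theorems.CardyUniqueLimitCardyRigidityDefs
import Literature.Probability.RandomPlanarGeometry.SLECardyLimit
import Literature.Probability.RandomPlanarGeometry.LocalMartingaleProofs
import Literature.Probability.Process.BrownianRunningSupTransfer
import HarnessLib

/-!
# `CardyRigidity` (stmt-CriticalPhenomena-0746), line `crossing-martingale`: tightness and
# load-bearing hypotheses of the analysis stubs `stub_betaPinning` / `stub_kernelAffineBeta`

By-product of the standing disprover (cdisprove) of the crux `CardyRigidity`
(`∀ f, (∀ R, R.HasCrossingLimit (bondDomainCrossingProb R) f) → EqOn f cardyFunction (Ioo 0 1)`,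
the same `Prop` in nine CardyFormulaZ2 route files) for the provers of the PICKED line
`Cruxes/CardyRigidity/Lines/crossing_martingale.lean` (4 stubs: `stub_crossingMartingale`,
`stub_kernelFacts`, `stub_betaPinning`, `stub_kernelAffineBeta`).

All objects (`betaLaw`, `markFlow`, `etaProc`, `levelTime`, `crossingObs`, `AdmissibleLevels`,
`IsRegularDriver`, `IsCrossingMartingaleFamily`) are THE LINE'S OWN, imported from its landed
definitions module `Theorems/CardyUniqueLimitCardyRigidityDefs.lean` (namespace
`…Cruxes.CardyRigidity.CrossingMartingale`), so every statement here is literally about the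
registered stub signatures.

* `isRegularDriver_sleDriving` — the SLE_κ driving function `√κ B` on the canonical space is a
  REGULAR DRIVER for the Brownian filtration (the `L³` running-supremum clause is the tree's
  `memLp_runSup_of_le_four`): the interface `IsRegularDriver` has a non-junk inhabitant.
* `crossingObs_sleDriving_six_eq` — for `W = √6 B` the line's level-stopped one-sided crossing
  observable with kernel `I_{2/3}` IS the tree's stopped Cardy observable `cardyObsStopped 6`
  (`levelTime = cardyLevelTime` definitionally; `I_{2/3} = F` on `[0,1]`).
* `isCrossingMartingaleFamily_betaLaw_two_thirds_six` — hence `(preWienerMeasure, √6 B, 𝓕ᵂ)` has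
  the CROSSING-MARTINGALE property for `I_{2/3}` (`martingale_cardyObsStopped_six`).
* `stub_betaPinning_tight` / `stub_betaPinning_conclusion_forced` — TIGHTNESS of STUB B: its
  hypothesis is satisfiable at `a = 2/3`, so any true statement of the shape
  "regular driver + `I_a`-crossing martingales ⇒ `a = c`" has `c = 2/3`; the strengthening
  "no `a ∈ (0,1)` admits such a driver" is false (`not_forall_betaLaw_noDriver`).
* `isCrossingMartingaleFamily_const`, `isRegularDriver_zero` — constant kernels have the
  crossing-martingale property for EVERY regular driver, and the zero path is a regular driver:
  the `A = 0` branch of STUB C is inhabited, and the strengthening of STUB C to a NON-DEGENERATE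
  affine Cardy law (`A ≠ 0`) is false (`not_stub_kernelAffineBeta_nondegenerate`).
* `stub_betaPinning_false_without_probability` — `IsProbabilityMeasure μ` is load-bearing in
  STUB B (with the zero measure every adapted process is a martingale).
-/

noncomputable section

open MeasureTheory Filter Set Topology
open scoped NNReal ENNReal
open Literature.Probability.RandomPlanarGeometry
open Literature.Probability.Process (exitTime preWienerMeasure brownian runSup runSup_nonneg
  abs_brownian_le_runSup memLp_runSup_of_le_four)

namespace Summit.CriticalPhenomena.CardyFormulaZ2.Theorems.CardyRigidity.Negative

open Summit.CriticalPhenomena.CardyFormulaZ2.Cruxes.CardyRigidity.CrossingMartingale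

/-! ### `I_{2/3}` is not constant on `(0,1)` -/

/-- `I_{2/3}` is not constant on `(0,1)`: it takes a value `< 1/2` and a value `> 1/2` there.
[folklore] -/
theorem exists_betaLaw_two_thirds_ne :
    ∃ η₁ ∈ Ioo (0 : ℝ) 1, ∃ η₂ ∈ Ioo (0 : ℝ) 1, betaLaw (2 / 3) η₁ ≠ betaLaw (2 / 3) η₂ := by
  have h₁ : ∀ᶠ η in 𝓝[>] (0 : ℝ), betaLaw (2 / 3) η < 1 / 2 ∧ η ∈ Ioo (0 : ℝ) 1 :=
    (tendsto_betaLaw_two_thirds_zero.eventually (Iio_mem_nhds (by norm_num))).and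
      (Ioo_mem_nhdsGT zero_lt_one)
  have h₂ : ∀ᶠ η in 𝓝[<] (1 : ℝ), 1 / 2 < betaLaw (2 / 3) η ∧ η ∈ Ioo (0 : ℝ) 1 :=
    (tendsto_betaLaw_two_thirds_one.eventually (Ioi_mem_nhds (by norm_num))).and
      (Ioo_mem_nhdsLT zero_lt_one)
  obtain ⟨η₁, hη₁, hη₁'⟩ := h₁.exists
  obtain ⟨η₂, hη₂, hη₂'⟩ := h₂.exists
  exact ⟨η₁, hη₁', η₂, hη₂', fun h ↦ by linarith⟩

/-! ### The SLE_κ driving function is a regular driver -/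

/-- **`√κ B` is a regular driver** on the canonical space `(ℝ≥0 → ℝ, preWienerMeasure)` for the
Brownian filtration: strongly adapted, continuous paths, `0` at time `0`, and the running
supremum of `|√κ B|` on `[0, t]` is dominated by `√κ · runSup t ∈ L³` (`memLp_runSup_of_le_four`).
[cite: KemppainenSmirnov2017, Thm 1.3] -/
theorem isRegularDriver_sleDriving (κ : ℝ≥0) :
    IsRegularDriver preWienerMeasure (fun ω ↦ sleDriving κ ω) brownianFiltration := by
  refine ⟨fun t ↦ ?_, continuous_sleDriving κ, sleDriving_zero κ, fun t ↦ ?_⟩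
  · exact (stronglyAdapted_brownian t).const_mul (Real.sqrt κ)
  · refine ⟨fun ω ↦ Real.sqrt κ * runSup t ω, ?_, fun ω ↦ ?_, ae_of_all _ fun ω u hu ↦ ?_⟩
    · exact (memLp_runSup_of_le_four t (by norm_num)).const_mul _
    · exact mul_nonneg (Real.sqrt_nonneg _) (runSup_nonneg t ω)
    · show |sleDriving κ ω u| ≤ Real.sqrt κ * runSup t ω
      rw [sleDriving_apply, abs_mul, abs_of_nonneg (Real.sqrt_nonneg _)]
      exact mul_le_mul_of_nonneg_left (abs_brownian_le_runSup hu ω) (Real.sqrt_nonneg _)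

/-- **The zero path is a regular driver** (for any finite measure and any filtration).
[folklore] -/
theorem isRegularDriver_zero {Ω : Type*} [MeasurableSpace Ω] (μ : Measure Ω) [IsFiniteMeasure μ]
    (𝓕 : Filtration ℝ≥0 ‹MeasurableSpace Ω›) : IsRegularDriver μ (fun _ _ ↦ 0) 𝓕 :=
  ⟨fun _ ↦ stronglyMeasurable_const, fun _ ↦ continuous_const, fun _ ↦ rfl,
    fun _ ↦ ⟨fun _ ↦ 0, memLp_const 0, fun _ ↦ le_rfl, ae_of_all _ fun _ _ _ ↦ by simp⟩⟩

/-! ### Identification of the line's observables with the tree's SLE₆ Cardy observable -/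

/-- For the driver `√κ B` the line's level stopping time IS the tree's `cardyLevelTime`
(definitionally: `markFlow (√κ B) y = sleRealFlowStop κ y`). [folklore] -/
theorem levelTime_sleDriving (κ : ℝ≥0) (x : Fin 3 → ℝ) (m M d : ℝ) :
    levelTime (fun ω ↦ sleDriving κ ω) x m M d = cardyLevelTime κ x m M d := rfl

/-- For the driver `√κ B` the line's level-stopped crossing observable with kernel `f` is `f` of
the cross-ratio of the tree's stopped three-point flow. [folklore] -/
theorem crossingObs_sleDriving_apply (f : ℝ → ℝ) (κ : ℝ≥0) (x : Fin 3 → ℝ) (m M d : ℝ)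
    (t : ℝ≥0) (ω : ℝ≥0 → ℝ) :
    crossingObs f (fun ω ↦ sleDriving κ ω) x m M d t ω =
      f (cardyEta (stoppedProcess (sleRealFlowStop κ (x 0)) (cardyLevelTime κ x m M d) t ω)
        (stoppedProcess (sleRealFlowStop κ (x 1)) (cardyLevelTime κ x m M d) t ω)
        (stoppedProcess (sleRealFlowStop κ (x 2)) (cardyLevelTime κ x m M d) t ω)) := rfl

/-- **For `W = √6 B` and admissible marks/levels, the line's `I_{2/3}`-crossing observable is the
tree's stopped Cardy observable `cardyObsStopped 6`** (the stopped cross-ratio lies in `(0,1)`,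
where `I_{2/3} = F`, `cardyFunction_eq_incBeta13_div_holds`). [cite: WernerPCMI2009, §3] -/
theorem crossingObs_sleDriving_six_eq {x : Fin 3 → ℝ} {m M d : ℝ} (h : AdmissibleLevels x m M d) :
    crossingObs (betaLaw (2 / 3)) (fun ω ↦ sleDriving 6 ω) x m M d = cardyObsStopped 6 x m M d := by
  funext t ω
  rw [crossingObs_sleDriving_apply]
  have hη := cardyEta_stopped_mem_Ioo (κ := 6) h.strictMono h.pos h.m_pos h.m_lt h.lt_M h.d_pos
    h.d_lt₁ h.d_lt₂ t ω
  rw [betaLaw_two_thirds, ← cardyFunction_eq_incBeta13_div_holds _ (Ioo_subset_Icc_self hη)]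
  rfl

/-- **The SLE₆ driver has the crossing-martingale property for the kernel `I_{2/3}`**
(`martingale_cardyObsStopped_six`: for `κ = 6` the Itô drift of the Cardy observable vanishes).
[cite: WernerPCMI2009, §3] -/
theorem isCrossingMartingaleFamily_betaLaw_two_thirds_six :
    IsCrossingMartingaleFamily (betaLaw (2 / 3)) preWienerMeasure (fun ω ↦ sleDriving 6 ω)
      brownianFiltration := by
  intro x m M d h
  rw [crossingObs_sleDriving_six_eq h]
  exact martingale_cardyObsStopped_six h.strictMono h.pos h.m_pos h.m_lt h.lt_M h.d_pos
    h.d_lt₁ h.d_lt₂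

/-- **Constant kernels have the crossing-martingale property for every driver** (finite
measure, any filtration): the observable is the constant process. [folklore] -/
theorem isCrossingMartingaleFamily_const {Ω : Type*} [MeasurableSpace Ω] (μ : Measure Ω)
    [IsFiniteMeasure μ] (c : ℝ) (W : Ω → ℝ≥0 → ℝ) (𝓕 : Filtration ℝ≥0 ‹MeasurableSpace Ω›) :
    IsCrossingMartingaleFamily (fun _ ↦ c) μ W 𝓕 :=
  fun _ _ _ _ _ ↦ martingale_const 𝓕 μ c

/-! ### Tightness of STUB B (`stub_betaPinning`) -/

/-- **STUB B is tight**: its hypothesis "regular driver whose level-stopped one-sided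
`I_a`-crossing observables are martingales" is SATISFIED at `a = 2/3` — by `√6 B` on the
canonical space with the Brownian filtration. [cite: WernerPCMI2009, §3] -/
theorem stub_betaPinning_tight :
    ∃ (Ω : Type) (_ : MeasurableSpace Ω) (μ : Measure Ω) (_ : IsProbabilityMeasure μ)
      (W : Ω → ℝ≥0 → ℝ) (𝓕 : Filtration ℝ≥0 ‹MeasurableSpace Ω›),
      IsRegularDriver μ W 𝓕 ∧ IsCrossingMartingaleFamily (betaLaw (2 / 3)) μ W 𝓕 :=
  ⟨ℝ≥0 → ℝ, inferInstance, preWienerMeasure, isProbabilityMeasure_preWienerMeasure',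
    fun ω ↦ sleDriving 6 ω, brownianFiltration, isRegularDriver_sleDriving 6,
    isCrossingMartingaleFamily_betaLaw_two_thirds_six⟩

/-- **The conclusion of STUB B is forced**: every true statement of the shape of
`stub_betaPinning` with conclusion `a = c` has `c = 2/3` (so the stub cannot be "improved" to any
other value, and a proof of it must genuinely distinguish `2/3`). [folklore] -/
theorem stub_betaPinning_conclusion_forced {c : ℝ}
    (h : ∀ a ∈ Ioo (0 : ℝ) 1, ∀ (Ω : Type) [MeasurableSpace Ω] (μ : Measure Ω)
      [IsProbabilityMeasure μ] (W : Ω → ℝ≥0 → ℝ) (𝓕 : Filtration ℝ≥0 ‹MeasurableSpace Ω›),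
      IsRegularDriver μ W 𝓕 → IsCrossingMartingaleFamily (betaLaw a) μ W 𝓕 → a = c) :
    c = 2 / 3 := by
  haveI := isProbabilityMeasure_preWienerMeasure'
  exact (h (2 / 3) ⟨by norm_num, by norm_num⟩ (ℝ≥0 → ℝ) preWienerMeasure (fun ω ↦ sleDriving 6 ω)
    brownianFiltration (isRegularDriver_sleDriving 6)
    isCrossingMartingaleFamily_betaLaw_two_thirds_six).symm

/-- **Refuted strengthening of STUB B**: "for NO `a ∈ (0,1)` does a regular driver have the
`I_a`-crossing-martingale property" is false (`a = 2/3`, `√6 B`). [folklore] -/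
theorem not_forall_betaLaw_noDriver :
    ¬ (∀ a ∈ Ioo (0 : ℝ) 1, ∀ (Ω : Type) [MeasurableSpace Ω] (μ : Measure Ω)
        [IsProbabilityMeasure μ] (W : Ω → ℝ≥0 → ℝ) (𝓕 : Filtration ℝ≥0 ‹MeasurableSpace Ω›),
        IsRegularDriver μ W 𝓕 → ¬ IsCrossingMartingaleFamily (betaLaw a) μ W 𝓕) := by
  intro h
  haveI := isProbabilityMeasure_preWienerMeasure'
  exact h (2 / 3) ⟨by norm_num, by norm_num⟩ (ℝ≥0 → ℝ) preWienerMeasure (fun ω ↦ sleDriving 6 ω)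
    brownianFiltration (isRegularDriver_sleDriving 6)
    isCrossingMartingaleFamily_betaLaw_two_thirds_six

/-! ### Load-bearing hypotheses -/

/-- **`IsProbabilityMeasure μ` is load-bearing in STUB B**: dropping it (allowing the zero
measure, under which every adapted process is a martingale) makes the statement false — witness
`a = 1/2`, the one-point space with the zero measure and the zero driver. [folklore] -/
theorem stub_betaPinning_false_without_probability :
    ¬ (∀ a ∈ Ioo (0 : ℝ) 1, ∀ (Ω : Type) [MeasurableSpace Ω] (μ : Measure Ω)
        (W : Ω → ℝ≥0 → ℝ) (𝓕 : Filtration ℝ≥0 ‹MeasurableSpace Ω›),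
        IsRegularDriver μ W 𝓕 → IsCrossingMartingaleFamily (betaLaw a) μ W 𝓕 → a = 2 / 3) := by
  intro h
  have key : IsCrossingMartingaleFamily (betaLaw (1 / 2)) (0 : Measure Unit) (fun _ _ ↦ 0) ⊥ := by
    intro x m M d _
    refine ⟨fun t ↦ ?_, fun i j _ ↦ ?_⟩
    · have : crossingObs (betaLaw (1 / 2)) (fun (_ : Unit) (_ : ℝ≥0) ↦ (0 : ℝ)) x m M d t =
          fun _ ↦ crossingObs (betaLaw (1 / 2)) (fun (_ : Unit) (_ : ℝ≥0) ↦ (0 : ℝ)) x m M d t () := by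
        funext u; rfl
      rw [this]
      exact stronglyMeasurable_const
    · rw [Filter.EventuallyEq, ae_zero]
      exact Filter.eventually_bot
  have := h (1 / 2) ⟨by norm_num, by norm_num⟩ Unit (0 : Measure Unit) (fun _ _ ↦ 0) ⊥
    (isRegularDriver_zero _ _) key
  norm_num at this

/-- **Refuted strengthening of STUB C** (`stub_kernelAffineBeta`): a crossing-martingale kernel
need NOT be a NON-DEGENERATE affine Cardy law — the conclusion
`∃ A B, A ≠ 0 ∧ f = A·I_{2/3} + B on (0,1)` fails for the constant kernel `f ≡ 0`, which has the
crossing-martingale property for the (regular) SLE₆ driver. So the affine freedom `A = 0` in the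
conclusion of STUB C is necessary, and the composition's separate treatment of constant kernels
(via the boundary values of STUB D) cannot be avoided. [folklore] -/
theorem not_stub_kernelAffineBeta_nondegenerate :
    ¬ (∀ f : ℝ → ℝ, ContinuousOn f (Ioo 0 1) →
        ∀ (Ω : Type) [MeasurableSpace Ω] (μ : Measure Ω) [IsProbabilityMeasure μ]
          (W : Ω → ℝ≥0 → ℝ) (𝓕 : Filtration ℝ≥0 ‹MeasurableSpace Ω›),
          IsRegularDriver μ W 𝓕 → IsCrossingMartingaleFamily f μ W 𝓕 →
            ∃ A B : ℝ, A ≠ 0 ∧ EqOn f (fun η ↦ A * betaLaw (2 / 3) η + B) (Ioo 0 1)) := by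
  intro h
  haveI := isProbabilityMeasure_preWienerMeasure'
  obtain ⟨A, B, hA, hAB⟩ := h (fun _ ↦ 0) continuousOn_const (ℝ≥0 → ℝ) preWienerMeasure
    (fun ω ↦ sleDriving 6 ω) brownianFiltration (isRegularDriver_sleDriving 6)
    (isCrossingMartingaleFamily_const _ _ _ _)
  obtain ⟨η₁, h₁, η₂, h₂, hne⟩ := exists_betaLaw_two_thirds_ne
  have e₁ := hAB h₁
  have e₂ := hAB h₂
  simp only at e₁ e₂
  exact hne (mul_left_cancel₀ hA (by linarith))

end Summit.CriticalPhenomena.CardyFormulaZ2.Theorems.CardyRigidity.Negative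

end
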